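import Mathlib.NumberTheory.ModularForms.EisensteinSeries.QExpansion
import Mathlib.NumberTheory.ZetaValues
import HarnessLib

/-!
# Row sums `Σ_{d ∈ ℤ} (w + d)⁻²` in closed form (Lipschitz, `k = 2`) — input of the `q`-expansion
# of the Weierstrass `℘`-function (Silverman, *Advanced Topics*, I.6.2 / V.1.1)

Topic `Literature/NumberTheory/EllipticCurves/TateCurve`, namespace
`Literature.NumberTheory.EllipticCurves.TateCurve` (abc-iut cell, TRANCHE-T1 P21; sub-lemma U-1a
of the discharge plan of the named fact `uniformization`: the complex identities behind Tate's
`X(u,q)`, `Y(u,q)` come from the `q`-expansion of `℘`, which is obtained by summing `℘`'s lattice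
series row by row). All PROVED, from Mathlib's `EisensteinSeries.qExpansion_identity`
(`Σ_{n ∈ ℤ} (z + n)^{-k-1} = ((−2πi)^{k+1}/k!) Σ_{n ≥ 0} nᵏ e^{2πinz}`) at `k = 1` and
`tsum_coe_mul_geometric_of_norm_lt_one` (`Σ n tⁿ = t/(1 − t)²`):

* `tsum_int_one_div_add_sq` : for `Im w > 0`, `Σ_{d ∈ ℤ} (w + d)⁻² = (2πi)² t/(1 − t)²`,
  `t = e^{2πiw}` (Silverman ATAEC I §6, the computation behind Prop. I.6.2: "`Σ_{n ∈ ℤ} 1/(x+n)²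
  = (2πi)² Σ_{n ≥ 1} n uⁿ`"…);
* `tsum_int_one_div_add_sq_of_im_neg` : the same closed form for `Im w < 0` (by `w ↦ −w`,
  `d ↦ −d` and `t/(1−t)² = t⁻¹/(1−t⁻¹)²`);
* `div_one_sub_sq_inv` : `t⁻¹/(1 − t⁻¹)² = t/(1 − t)²`;
* `hasSum_int_one_div_sq` : `Σ_{d ∈ ℤ} d⁻² = π²/3` (`= 2ζ(2)`, with Lean's `0⁻¹ = 0` at `d = 0`).

## References
* [SilvermanATAEC1994] J. H. Silverman, *Advanced Topics in the Arithmetic of Elliptic Curves*,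
  GTM 151, Springer 1994, Ch. I §6 (Prop. I.6.2, `q`-expansion of `℘`) and Ch. V §1 (Thm. V.1.1).
-/

noncomputable section

open Complex Real
open UpperHalfPlane hiding I

namespace Literature.NumberTheory.EllipticCurves.TateCurve

/-- `t⁻¹/(1 − t⁻¹)² = t/(1 − t)²` (the symmetry `u ↦ u⁻¹` of `X(u,q)`; Silverman ATAEC, proof of
V.3.1 (c), "the second from the rearranged series"). [cite: SilvermanATAEC1994, Thm. V.3.1 (c) (proof, PDF p. 396)] -/
theorem div_one_sub_sq_inv (t : ℂ) : t⁻¹ / (1 - t⁻¹) ^ 2 = t / (1 - t) ^ 2 := by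
  rcases eq_or_ne t 0 with rfl | ht
  · simp
  rcases eq_or_ne t 1 with rfl | ht1
  · simp
  have h1 : (1 - t) ≠ 0 := sub_ne_zero.mpr (Ne.symm ht1)
  have h2 : (1 - t⁻¹) ≠ 0 := by
    rw [sub_ne_zero, ne_eq, eq_comm, inv_eq_one]; exact ht1
  field_simp
  ring

/-- **Lipschitz's formula for `k = 2`:** for `Im w > 0`,
`Σ_{d ∈ ℤ} (w + d)⁻² = (2πi)² · t/(1 − t)²` with `t = e^{2πiw}` (Mathlib's
`EisensteinSeries.qExpansion_identity` at `k = 1` and `Σ n tⁿ = t/(1−t)²`). This is the row sum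
in the `q`-expansion of `℘` (Silverman ATAEC Prop. I.6.2 / Thm. V.1.1).
[cite: SilvermanATAEC1994, Thm. V.1.1 (proof, PDF pp. 385–386)] -/
theorem tsum_int_one_div_add_sq (w : ℍ) :
    ∑' d : ℤ, 1 / ((w : ℂ) + d) ^ 2 =
      (2 * π * I) ^ 2 * (cexp (2 * π * I * w) / (1 - cexp (2 * π * I * w)) ^ 2) := by
  have h := EisensteinSeries.qExpansion_identity (k := 1) le_rfl w
  have hq : ‖cexp (2 * π * I * w)‖ < 1 := norm_exp_two_pi_I_lt_one w
  have hsum : ∑' n : ℕ, (n : ℂ) ^ 1 * cexp (2 * π * I * w) ^ n =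
      cexp (2 * π * I * w) / (1 - cexp (2 * π * I * w)) ^ 2 := by
    simp only [pow_one]
    exact tsum_coe_mul_geometric_of_norm_lt_one hq
  rw [show (1 + 1 : ℕ) = 2 from rfl] at h
  rw [h, hsum, Nat.factorial_one, Nat.cast_one, div_one]
  ring

/-- The row sum for `Im w < 0`: the same closed form `Σ_{d ∈ ℤ} (w + d)⁻² = (2πi)² t/(1 − t)²`,
`t = e^{2πiw}` (apply the previous formula to `−w` and use `t⁻¹/(1−t⁻¹)² = t/(1−t)²`).
[cite: SilvermanATAEC1994, Thm. V.1.1 (proof, PDF pp. 385–386)] -/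
theorem tsum_int_one_div_add_sq_of_im_neg {w : ℂ} (hw : w.im < 0) :
    ∑' d : ℤ, 1 / (w + d) ^ 2 =
      (2 * π * I) ^ 2 * (cexp (2 * π * I * w) / (1 - cexp (2 * π * I * w)) ^ 2) := by
  have hw' : 0 < (-w).im := by simpa using hw
  have h := tsum_int_one_div_add_sq ⟨-w, hw'⟩
  rw [UpperHalfPlane.coe_mk] at h
  -- reindex `d ↦ -d`
  have hre : ∑' d : ℤ, 1 / (w + d) ^ 2 = ∑' d : ℤ, 1 / (-w + d) ^ 2 := by
    rw [← (Equiv.neg ℤ).tsum_eq]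
    refine tsum_congr fun d ↦ ?_
    simp only [Equiv.neg_apply, Int.cast_neg]
    rw [show (w + -(d : ℂ)) = -(-w + d) by ring, neg_sq]
  rw [hre, h]
  congr 1
  rw [show (2 * π * I * -w) = -(2 * π * I * w) by ring, Complex.exp_neg]
  exact div_one_sub_sq_inv _

/-- `Σ_{d ∈ ℤ} d⁻² = π²/3` (`= 2ζ(2)`; the `d = 0` term is `0` by Lean's `0⁻¹ = 0`) — the
constant of the `c = 0` row in the `q`-expansion of `℘`.
[cite: SilvermanATAEC1994, Thm. V.1.1 (proof, PDF pp. 385–386)] -/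
theorem hasSum_int_one_div_sq :
    HasSum (fun d : ℤ ↦ 1 / (d : ℂ) ^ 2) ((π : ℂ) ^ 2 / 3) := by
  have hR := hasSum_zeta_two
  have hC : HasSum (fun n : ℕ ↦ 1 / (n : ℂ) ^ 2) ((π : ℂ) ^ 2 / 6) := by
    have := (Complex.ofRealCLM.hasSum hR)
    simp only [Complex.ofRealCLM_apply, Complex.ofReal_div, Complex.ofReal_one, Complex.ofReal_pow,
      Complex.ofReal_natCast, Complex.ofReal_ofNat] at this
    exact this
  have hC' : HasSum (fun n : ℕ ↦ 1 / ((-(n + 1 : ℤ) : ℤ) : ℂ) ^ 2) ((π : ℂ) ^ 2 / 6) := by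
    have h1 : HasSum (fun n : ℕ ↦ 1 / ((n + 1 : ℕ) : ℂ) ^ 2) ((π : ℂ) ^ 2 / 6) := by
      rw [← hasSum_nat_add_iff' 1] at hC
      simpa using hC
    refine h1.congr_fun fun n ↦ ?_
    push_cast
    ring
  have := HasSum.of_nat_of_neg_add_one (f := fun d : ℤ ↦ 1 / (d : ℂ) ^ 2) hC hC'
  convert this using 1
  ring

end Literature.NumberTheory.EllipticCurves.TateCurve

end
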